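import Summits.BirchSwinnertonDyer.BirchSwinnertonDyer.Theorems.UniversalToricDescentTwinSplitUnitPairSelmerHalf
import Summits.BirchSwinnertonDyer.BirchSwinnertonDyer.Theorems.SchneiderFreeAdditiveX3PoitouTateSelmerDualityHolds
import Summits.BirchSwinnertonDyer.Rank1Residual.GaloisImage.PropagatedConditionCardEP
import Summits.BirchSwinnertonDyer.Rank1Residual.X11b.HalvesReceptacle
import Literature.NumberTheory.EllipticCurves.UnrIntegersUnits
import HarnessLib

/-!
# Route `UniversalToricDescent`, crux `TwinAlgMuZeroAtThree` (stmt-BirchSwinnertonDyer-24737, R2 text of rev 87):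
# its conclusion HOLDS, UNCONDITIONALLY, at every rank-one UNIT datum of buckets B (multiplicative très ramifié) and
# C₀ (good supersingular) — tier U read into the item's own currency

Width prover `bsd-wall-utd-p1-w2` g8 (cell `bsd-wall`), `--supports stmt-BirchSwinnertonDyer-24737`. THEOREMS ONLY (no
definition, no named fact, no `sorry`).

The R2 text of `TwinAlgMuZeroAtThree` concludes, at a twin `W′`, a Heegner field `K`, an anticyclotomic `κ` with
topological generator `γ` and the strict slot `𝔭′ ∣ 3`:
`Module.IsTorsion Λ (XAc (W′/K) 3 κ 𝔭′ ∅ γ) ∧ ∃ g′, Ch_Λ(XAc)·R₀⟦T⟧ = (g′) ∧ ∃ i, ‖g′ᵢ‖ = 1`.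
The tree already holds (utd-p2 g3, 2026-08-28, `…TwinSplitUnitPairSelmerHalf`) the CONTROL-FREE vanishing
`XAc.HasCharValuationAt (W′/K) 3 κ 𝔭′ ∅ γ 0` at a rank-one UNIT datum (`selmerHalf_instance_of_mult_unit`,
`selmerHalf_instance_of_goodSS_unit`), conditional on two cited cohomological facts taken as hypotheses `hPT`, `hEP`.
Both are now TREE THEOREMS: `SchneiderFreeAdditiveX3.PoitouTateReduction.poitouTate_selmerStructure_duality_holds`
(cell `bsd-schneider`, p624636) and `Rank1Residual.GaloisImage.EP.localEulerPoincareCharacteristic_adicCompletion`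
(cell `b2b-bsdres`, Milne ADT I 2.8). This file

* §1 `isTorsion_and_exists_generator_of_hasCharValuationAt_zero` — for ANY curve over a number field, prime `p`,
  `ℤ_p`-extension, slot, `Σ`: `XAc.HasCharValuationAt … 0` implies the conclusion SHAPE of `TwinAlgMuZeroAtThree`
  (the generator `f` with `ord_p f(0) = 0` maps to `R₀⟦T⟧` with a unit constant coefficient);
* §2 `twinAlgMu_at_mult_unit` / `twinAlgMu_at_goodSS_unit` — the conclusion of item 24737 AT a rank-one unit datum of
  bucket B resp. C₀, with `hPT` / `hEP` DISCHARGED: unconditional modulo the per-pair numerics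
  (`P` non-torsion, `ord₃ log_ω P = 1`, `3 ∤ ∏ c_w`, `3 ∤ [W′(K) : ℤP]`, `rank W′(K) = 1`, `Ш(W′/K)[3^∞] = 0`).

HONEST FRAMING: per-datum theorems (tier U); they do NOT close the ∀-item 24737, whose research content on B ∪ C₀ off the
unit tier is untouched; no class count moves; BSD is proved for no curve by this file.

References: [JetchevSkinnerWan2017] Prop. 3.2.1; [GreenbergLNM1716] §3–§4; [MilneADT2006] I Thm. 2.8, Thm. 4.10 (b);
[Washington1997] §13.2.
-/

set_option linter.dupNamespace false
set_option autoImplicit false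

noncomputable section

open scoped Classical

open NumberField IsDedekindDomain Field
open Literature.NumberTheory.EllipticCurves Literature.NumberTheory.EllipticCurves.GreenbergSelmer
open Literature.NumberTheory.GaloisRepresentations

namespace Summit.BirchSwinnertonDyer.BirchSwinnertonDyer.Theorems.UniversalToricDescentTwinAlgMuUnitPairs

open Summit.BirchSwinnertonDyer.Rank1Residual.X11b
open Summit.BirchSwinnertonDyer.Rank1Residual.X11b.AcSelmer
open Summit.BirchSwinnertonDyer.Rank1Residual.X11b.Halves
open Literature.NumberTheory.EllipticCurves.Rank1Residual
open Summit.BirchSwinnertonDyer.BirchSwinnertonDyer.Theorems.UniversalToricDescentTwinSplit.VanishingControl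

/-! ## §1 `HasCharValuationAt … 0 ⟹` the conclusion shape of `TwinAlgMuZeroAtThree` (any `p`, any curve) -/

section Shape

variable {K : Type} [Field K] [NumberField K] (W : WeierstrassCurve K) (p : ℕ) [Fact p.Prime]
  (κ : ZpExtension K p) (𝔭 : HeightOneSpectrum (𝓞 K)) (S : Set (HeightOneSpectrum (𝓞 K)))
  (γ : absoluteGaloisGroup K) [Fact (κ.IsTopGenerator γ)]

/-- **`XAc.HasCharValuationAt … 0` gives the conclusion shape of `TwinAlgMuZeroAtThree`**: `X_ac` is `Λ`-torsion and
`Ch_Λ(X_ac)·R₀⟦T⟧ = (g)` for a `g` with a coefficient of norm `1` — take `g` the image of the generator `f` with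
`ord_p f(0) = 0`; its constant coefficient is a unit of `R₀`. [cite: Washington1997, §13.2] -/
theorem isTorsion_and_exists_generator_of_hasCharValuationAt_zero
    (h : XAc.HasCharValuationAt W p κ 𝔭 S γ 0) :
    Module.IsTorsion (IwasawaAlgebra p) (XAc W p κ 𝔭 S γ) ∧
      ∃ g : UnrSeries p,
        (XAc.charIdeal W p κ 𝔭 S γ).map (PowerSeries.map (toUnr p)) = Ideal.span {g} ∧
          ∃ i : ℕ, ‖((PowerSeries.coeff i g : unrIntegers p) : ℂ_[p])‖ = 1 := by
  obtain ⟨hT, f, hf, hf0, hval⟩ := h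
  refine ⟨hT, PowerSeries.map (toUnr p) f, ?_, 0, ?_⟩
  · rw [hf, Ideal.map_span, Set.image_singleton]
  · -- a `p`-adic integer of valuation `0` is a unit (cf. `EtaPrimeRoad.isUnit_of_valuation_eq_zero`)
    have hu : IsUnit (PowerSeries.constantCoeff f) := by
      rw [PadicInt.isUnit_iff, PadicInt.norm_eq_zpow_neg_valuation hf0]
      have hv : (PowerSeries.constantCoeff f).valuation = 0 := by exact_mod_cast hval
      rw [hv]
      simp
    have hu' : IsUnit (PowerSeries.coeff 0 (PowerSeries.map (toUnr p) f)) := by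
      rw [PowerSeries.coeff_map, PowerSeries.coeff_zero_eq_constantCoeff]
      exact hu.map (toUnr p)
    exact (unrIntegers.isUnit_iff_norm_eq_one _).mp hu'

end Shape

/-! ## §2 Item 24737's conclusion AT a rank-one unit datum, `hPT` / `hEP` discharged -/

/-- **Bucket B (multiplicative at `3`, très ramifié or non-split), rank-one UNIT datum: the conclusion of
`TwinAlgMuZeroAtThree` HOLDS at `(W′, K, κ, γ, 𝔭′)`** — `X_ac(W′/K_∞)` strict at the degree-one slot `𝔭′` is `Λ`-torsion
and `Ch_Λ·R₀⟦T⟧ = (g′)` with a norm-one coefficient (indeed `= R₀⟦T⟧`). UNCONDITIONAL modulo the per-pair numerics: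
`selmerHalf_instance_of_mult_unit` with Poitou–Tate duality for Selmer structures
(`poitouTate_selmerStructure_duality_holds`) and Tate's local Euler–Poincaré characteristic
(`EP.localEulerPoincareCharacteristic_adicCompletion`) supplied as theorems.
[cite: JetchevSkinnerWan2017, Prop. 3.2.1 and (7.1.5)] [cite: GreenbergLNM1716, §3 Lemma 3.3, §4]
[cite: MilneADT2006, I Thm. 2.8, Thm. 4.10 (b)] -/
theorem twinAlgMu_at_mult_unit (K : Type) [Field K] [NumberField K]
    (W' : WeierstrassCurve ℚ) [W'.IsElliptic] [W'.IsGloballyMinimal] (N' : ℕ) [NeZero N']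
    (hm : Mult W' 3)
    (hside : ¬ W'.HasSplitMultiplicativeReductionAtPrime 3 ∨
      ¬ 3 ∣ padicValInt 3 W'.minimalDiscriminantInt)
    (hsurj : W'.HasSurjectiveModNGaloisRep 3) (hN' : W'.conductorNorm ℤ = N')
    (hK : IsImaginaryQuadratic K) (hH : SatisfiesHeegnerHypothesis N' K)
    (κ : ZpExtension K 3) (γ : absoluteGaloisGroup K) [Fact (κ.IsTopGenerator γ)]
    (𝔭' : HeightOneSpectrum (𝓞 K)) (h𝔭' : ((3 : ℕ) : 𝓞 K) ∈ 𝔭'.asIdeal)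
    (he' : 𝔭'.asIdeal.ramificationIdx (𝓞 ℚ) = 1) (hf' : 𝔭'.asIdeal.inertiaDeg (𝓞 ℚ) = 1)
    (P : (W'.baseChange K).toAffine.Point) (hP0 : ¬ IsOfFinAddOrder P)
    (hlog : Literature.NumberTheory.EllipticCurves.padicLogOrd W' 3 (embAt K 3 𝔭' h𝔭' he' hf') P = 1)
    (htam : ¬ 3 ∣ (W'.baseChange K).tamagawaProduct)
    (hidx : ¬ 3 ∣ (AddSubgroup.zmultiples P).index)
    (hrk : (W'.baseChange K).mordellWeilRank = 1)
    (hSha : AddCommGroup.primaryComponent (W'.baseChange K).sha 3 = ⊥) :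
    Module.IsTorsion (IwasawaAlgebra 3) (XAc (W'.baseChange K) 3 κ 𝔭' ∅ γ) ∧
      ∃ g' : UnrSeries 3,
        (XAc.charIdeal (W'.baseChange K) 3 κ 𝔭' ∅ γ).map (PowerSeries.map (toUnr 3)) = Ideal.span {g'} ∧
          ∃ i : ℕ, ‖((PowerSeries.coeff i g' : unrIntegers 3) : ℂ_[3])‖ = 1 :=
  isTorsion_and_exists_generator_of_hasCharValuationAt_zero (W'.baseChange K) 3 κ 𝔭' ∅ γ
    (selmerHalf_instance_of_mult_unit K
      (SchneiderFreeAdditiveX3.PoitouTateReduction.poitouTate_selmerStructure_duality_holds K)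
      (fun v ↦ Summit.BirchSwinnertonDyer.Rank1Residual.GaloisImage.EP.localEulerPoincareCharacteristic_adicCompletion K v)
      W' N' hm hside hsurj hN' hK hH κ γ 𝔭' h𝔭' he' hf' P hP0 hlog htam hidx hrk hSha)

/-- **Bucket C₀ (good supersingular at `3`), rank-one UNIT datum: the conclusion of `TwinAlgMuZeroAtThree` HOLDS at
`(W′, K, κ, γ, 𝔭′)`**, UNCONDITIONAL modulo the per-pair numerics: `selmerHalf_instance_of_goodSS_unit` with
`poitouTate_selmerStructure_duality_holds` and `EP.localEulerPoincareCharacteristic_adicCompletion` supplied as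
theorems. (`a₃ = 0` is not needed: `GoodSS W′ 3` alone gives `3 ∤ #W̃′(𝔽₃)`.)
[cite: JetchevSkinnerWan2017, Prop. 3.2.1 and (7.1.5)] [cite: GreenbergLNM1716, §3 Lemma 3.3, §4]
[cite: MilneADT2006, I Thm. 2.8, Thm. 4.10 (b)] [cite: Kim2022StructureSelmer, §3.1.1] -/
theorem twinAlgMu_at_goodSS_unit (K : Type) [Field K] [NumberField K]
    (W' : WeierstrassCurve ℚ) [W'.IsElliptic] [W'.IsGloballyMinimal]
    (hss : GoodSS W' 3) (hsurj : W'.HasSurjectiveModNGaloisRep 3) (hK : IsImaginaryQuadratic K)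
    (κ : ZpExtension K 3) (γ : absoluteGaloisGroup K) [Fact (κ.IsTopGenerator γ)]
    (𝔭' : HeightOneSpectrum (𝓞 K)) (h𝔭' : ((3 : ℕ) : 𝓞 K) ∈ 𝔭'.asIdeal)
    (he' : 𝔭'.asIdeal.ramificationIdx (𝓞 ℚ) = 1) (hf' : 𝔭'.asIdeal.inertiaDeg (𝓞 ℚ) = 1)
    (P : (W'.baseChange K).toAffine.Point) (hP0 : ¬ IsOfFinAddOrder P)
    (hlog : Literature.NumberTheory.EllipticCurves.padicLogOrd W' 3 (embAt K 3 𝔭' h𝔭' he' hf') P = 1)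
    (htam : ¬ 3 ∣ (W'.baseChange K).tamagawaProduct)
    (hidx : ¬ 3 ∣ (AddSubgroup.zmultiples P).index)
    (hrk : (W'.baseChange K).mordellWeilRank = 1)
    (hSha : AddCommGroup.primaryComponent (W'.baseChange K).sha 3 = ⊥) :
    Module.IsTorsion (IwasawaAlgebra 3) (XAc (W'.baseChange K) 3 κ 𝔭' ∅ γ) ∧
      ∃ g' : UnrSeries 3,
        (XAc.charIdeal (W'.baseChange K) 3 κ 𝔭' ∅ γ).map (PowerSeries.map (toUnr 3)) = Ideal.span {g'} ∧
          ∃ i : ℕ, ‖((PowerSeries.coeff i g' : unrIntegers 3) : ℂ_[3])‖ = 1 :=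
  isTorsion_and_exists_generator_of_hasCharValuationAt_zero (W'.baseChange K) 3 κ 𝔭' ∅ γ
    (selmerHalf_instance_of_goodSS_unit K
      (SchneiderFreeAdditiveX3.PoitouTateReduction.poitouTate_selmerStructure_duality_holds K)
      (fun v ↦ Summit.BirchSwinnertonDyer.Rank1Residual.GaloisImage.EP.localEulerPoincareCharacteristic_adicCompletion K v)
      W' hss hsurj hK κ γ 𝔭' h𝔭' he' hf' P hP0 hlog htam hidx hrk hSha)

end Summit.BirchSwinnertonDyer.BirchSwinnertonDyer.Theorems.UniversalToricDescentTwinAlgMuUnitPairs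

end
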